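import Summits.BirchSwinnertonDyer.BirchSwinnertonDyer.Theses.QuadraticBranchSignedControl
import Summits.BirchSwinnertonDyer.BirchSwinnertonDyer.Theorems.QuadraticBranchSignedControlPlusKatoDivisibilityIotaOfNamedFactsContra
import HarnessLib

/-!
# K8 crux `PlusKatoDivisibilityBranchOntoIotaOfNamedInputs` (item stmt-BirchSwinnertonDyer-26765, gen-2 child 1 of 20445) CLOSED BY
# NAME: the three print-exact named inputs `h12`, `hZ′`, `Q73′` imply (RK⁺)^ι on the tower-onto Gss2 rows

Cell `bsd-potss` (HOME `run/shared/lean/pub/bsd-potss/`), seat `bsd-potss-k8q-c2x` g10 (prover; lane B of the K8 Kato side), duty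
T-Q73ι-2 «K8-IOTA» (planner g27 edit B″, 2026-08-28T07:40Z). HONEST FRAMING: ONE THEOREM, no definition, no named fact, no `sorry`;
its type is LITERALLY the route decl (the gate compares it with the item). The crux is an IMPLICATION from three held print-exact
Literature facts (`Kobayashi2003.thm12_signedSelmerDual_finite_torsion`, `Kobayashi2003.thm62_63_73_etaColemanPoitouTate_zeta_contra`
p608027, `Kato2004.thm13_4_lengthAt_fineSelmerDualContra_le_of_isEulerSystemClass` p600084) to
`Additive.QuadraticBranchPlusKatoDivisibilityIotaAt V p` on every tower-onto row; it is discharged by the seat's producer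
`KatoSideIotaContra.plusKatoDivisibilityBranchOntoIota_ofNamedFactsContra` (p612326: η-twist lemma + same-prime contragredient
four-term road + the proved descent frame), re-ordering the hypotheses. Closing this item does NOT prove Kato's or Kobayashi's
theorems (they remain named inputs of the parent's other children), proves BSD for no curve, and books nothing.

References: [Kobayashi2003] Thm. 1.2, 2.2, 4.1, 6.2–6.3, Cor. 7.2, Thm. 7.3 i) (7.21); [Kato2004Asterisque] Thm. 13.4 (p. 226),
(12.5.2) (p. 222); [Greenberg1989] pp. 101–102 (`S^ι`).
-/

noncomputable section

-- justification: the `Summit.BirchSwinnertonDyer.BirchSwinnertonDyer.…` path repeats a component (route-file convention)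
set_option linter.dupNamespace false

namespace Summit.BirchSwinnertonDyer.BirchSwinnertonDyer.Theorems

open Summit.BirchSwinnertonDyer.BirchSwinnertonDyer.Theses.QuadraticBranchSignedControl

/-- **Closes K8 crux `PlusKatoDivisibilityBranchOntoIotaOfNamedInputs` (gen-2 child 1 of item 20445):**
`Kobayashi2003.thm12_signedSelmerDual_finite_torsion → Kobayashi2003.thm62_63_73_etaColemanPoitouTate_zeta_contra →
Kato2004.thm13_4_lengthAt_fineSelmerDualContra_le_of_isEulerSystemClass → ∀ V p, 5 ≤ p → good → a_p = 0 → (∀ m, ρ̄_{V,p^m} onto) →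
Additive.QuadraticBranchPlusKatoDivisibilityIotaAt V p` — by the seat's Theorems producer
`KatoSideIotaContra.plusKatoDivisibilityBranchOntoIota_ofNamedFactsContra` (hypotheses re-ordered). Print-exact on the tree's
duals (`Char X⁺(V/ℚ_∞)·(ι L_p⁺(V,η,X)) ⊆ Char X⁺(V/F_∞)`); no functional equation, no `ι`-symmetry hypothesis.
[cite: Kobayashi2003, Thm. 4.1 (p. 8), Thm. 2.2 (p. 5), Thm. 1.2 (p. 2), Thm. 7.3 i) (7.21) (p. 13)]
[cite: Kato2004Asterisque, Thm. 13.4 (2)(3) (p. 226), (12.5.2) (p. 222)] -/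
theorem plusKatoDivisibilityBranchOntoIotaOfNamedInputs_proof : PlusKatoDivisibilityBranchOntoIotaOfNamedInputs := by
  intro h12 hZc h134c
  exact KatoSideIotaContra.plusKatoDivisibilityBranchOntoIota_ofNamedFactsContra hZc h134c h12

end Summit.BirchSwinnertonDyer.BirchSwinnertonDyer.Theorems

end
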